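import Literature.AlgebraicGeometry.Resolution.KollarPushforward
import Literature.AlgebraicGeometry.Resolution.HypersurfacePushforward
import Literature.AlgebraicGeometry.Resolution.RegularBlowup
import Literature.AlgebraicGeometry.Resolution.BlowupsIntegral
import Literature.AlgebraicGeometry.Resolution.BlowupSequencesRestrictMarked
import Summits.ResolutionOfSingularities.ResolutionOfSingularities.Theorems.HilbertSamuelEliminationSigmaMaxModificationsStubCentreSeqPackage
import Mathlib.AlgebraicGeometry.Morphisms.Proper
import Mathlib.AlgebraicGeometry.Noetherian
import HarnessLib

/-!
# Route `HilbertSamuelElimination`, crux `SigmaMaxModificationsCorridor3`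
# (stmt-ResolutionOfSingularities-19249; child of `SigmaMaxModifications` stmt-…-18506),
# line `tame_wild` v3.1 (confined form) — brick T3, STRUCTURAL PART: the embedded tower along
# Kollár's push-forward

[OURS · L1 W4.2] Towards brick T3 (`stub_T3_embeddedTower` of the lead's helpers-v3): for a closed
immersion `ι : U → Z` into a regular integral scheme `Z`, separated of finite type over a field with
`dim Z ≤ 4`, with `ι.ker ≠ 0`, and a blow-up sequence `r : CentreSeq U` in regular centres, the
push-forward `r.pushforward ι` (Kollár 3.30.3, tree `CentreSeq.pushforward`) has a regular integral top
of dimension `≤ 4`, separated of finite type over the field, and the last natural inclusion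
`r.pushforwardι ι : r.top → (r.pushforward ι).top` is a closed immersion over `ι` (Kollár: "if `B` is a
smooth blow-up sequence then so is `j_* B`"). What remains for T3 is the kernel of `r.pushforwardι ι`:
an effective Cartier ideal sheaf when `ι.ker` is (one-step plan in helpers-v3 §STATE, via
`IsBlowup.ker_strictTransformHom_of_isEffectiveCartier`). NOT a statement of any manuscript.

## Sources

* J. Kollár, *Lectures on Resolution of Singularities* (2007), 3.30.3, Notation 3.19. [Kollar2007]
* The Stacks Project, Tags 02ND, 0806. [StacksProject]
-/

set_option linter.dupNamespace false -- mandated namespace of this single-conjunct summit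

noncomputable section

open CategoryTheory AlgebraicGeometry TopologicalSpace Topology
open Literature.AlgebraicGeometry.Resolution
open Summit.ResolutionOfSingularities.ResolutionOfSingularities.Theorems.SigmaMaxModifications.Sketch

namespace Summit.ResolutionOfSingularities.ResolutionOfSingularities.Theorems.SigmaMaxModificationsCorridor3.Helpers

/-- **The embedded tower along the push-forward — structural part.** Induction along the
sequence: each step blows `Z` up along the regular centre `ι_* C'` (regular:
`isRegular_subscheme_map_iff_of_isClosedImmersion`) — the top is regular
(`IsBlowup.isRegular_of_isRegular_subscheme`), integral (`IsBlowup.isIntegral`, as `ι_* C' ⊇ ker ι ≠ 0`),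
of dimension `≤ 4` (`topologicalKrullDim_top_le`), proper over `Z`; the next natural inclusion
`j₁ = blowup.pushforwardMap C' ι` is a closed immersion over `ι`, and its kernel is again nonzero:
otherwise `j₁` would be surjective, so the non-empty open complement of the centre (over which the
blow-up is an isomorphism, `IsBlowup.isIso_compl`) would lie in the image of `ι`, i.e. in the proper
closed subset `V(ker ι)` of the irreducible `Z`. [cite: Kollar2007, 3.30.3, Notation 3.19]
[cite: StacksProject, Tag 02ND, Tag 02OS] -/
theorem tower_structural (k : Type) [Field k] :
    ∀ {U Z : Scheme.{0}} (h : Z ⟶ Spec (.of k)) [IsSeparated h] [LocallyOfFiniteType h]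
      [QuasiCompact h], IsIntegral Z → Scheme.IsRegular Z →
      topologicalKrullDim Z ≤ ((4 : ℕ) : WithBot ℕ∞) →
      ∀ (ι : U ⟶ Z) [IsClosedImmersion ι], ι.ker ≠ ⊥ → ∀ (r : CentreSeq U), r.AllRegular →
        IsSeparated ((r.pushforward ι).comp ≫ h) ∧ LocallyOfFiniteType ((r.pushforward ι).comp ≫ h) ∧
        QuasiCompact ((r.pushforward ι).comp ≫ h) ∧ IsIntegral (r.pushforward ι).top ∧
        Scheme.IsRegular (r.pushforward ι).top ∧
        topologicalKrullDim (r.pushforward ι).top ≤ ((4 : ℕ) : WithBot ℕ∞) ∧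
        IsClosedImmersion (r.pushforwardι ι) ∧
        r.pushforwardι ι ≫ (r.pushforward ι).comp = r.comp ≫ ι
  | U, Z, h, _, _, _, hZi, hZ, hdim, ι, _, hker, .nil _, _ => by
    refine ⟨?_, ?_, ?_, ?_, ?_, ?_, ?_, ?_⟩
    · simpa using (inferInstance : IsSeparated h)
    · simpa using (inferInstance : LocallyOfFiniteType h)
    · simpa using (inferInstance : QuasiCompact h)
    · simpa using hZi
    · simpa using hZ
    · exact hdim
    · simpa using (inferInstance : IsClosedImmersion ι)
    · simp
  | U, Z, h, _, _, _, hZi, hZ, hdim, ι, _, hker, .cons C' rest, hr => by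
    obtain ⟨hC', hrest⟩ := hr
    haveI : IsLocallyNoetherian Z := LocallyOfFiniteType.isLocallyNoetherian h
    haveI := hZi
    -- the first step: blow `Z` up along `ι_* C'`
    have hC : Scheme.IsRegular (C'.map ι).subscheme :=
      (isRegular_subscheme_map_iff_of_isClosedImmersion ι C').mpr hC'
    have hCne : C'.map ι ≠ ⊥ := fun h0 => hker (le_bot_iff.mp (h0 ▸ ker_le_map C' ι))
    haveI : IsProper (blowup.π (C'.map ι)) := (blowup.isBlowup (C'.map ι)).isProper
    have hZ₁i : IsIntegral (blowup (C'.map ι)) := (blowup.isBlowup (C'.map ι)).isIntegral hCne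
    have hZ₁ : Scheme.IsRegular (blowup (C'.map ι)) :=
      (blowup.isBlowup (C'.map ι)).isRegular_of_isRegular_subscheme hZ hC
    have hdim₁ : topologicalKrullDim (blowup (C'.map ι)) ≤ ((4 : ℕ) : WithBot ℕ∞) := by
      exact topologicalKrullDim_top_le (CentreSeq.single (C'.map ι)) hdim
    haveI : IsSeparated (blowup.π (C'.map ι) ≫ h) := inferInstance
    haveI : LocallyOfFiniteType (blowup.π (C'.map ι) ≫ h) := inferInstance
    haveI : QuasiCompact (blowup.π (C'.map ι) ≫ h) := inferInstance
    -- the next natural inclusion has nonzero kernel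
    have hker₁ : (blowup.pushforwardMap C' ι).ker ≠ ⊥ := by
      intro h0
      haveI : IsClosedImmersion (blowup.pushforwardMap C' ι) := inferInstance
      -- `ker j₁ = ⊥` forces `j₁` to be surjective
      have hrange : Set.range (blowup.pushforwardMap C' ι).base = Set.univ := by
        have h1 := Scheme.Hom.support_ker (blowup.pushforwardMap C' ι)
        rw [h0, Scheme.IdealSheafData.support_bot,
          (blowup.pushforwardMap C' ι).isClosedEmbedding.isClosed_range.closure_eq] at h1
        rw [← h1]
        simp
      -- the complement of the centre is a non-empty open over which `π` is an isomorphism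
      let U₀ : Z.Opens := ⟨((C'.map ι).support : Set Z)ᶜ, (C'.map ι).support.isClosed.isOpen_compl⟩
      have hsupp : ((C'.map ι).support : Set Z) ≠ Set.univ := by
        intro h1
        apply hCne
        rw [← Scheme.IdealSheafData.support_eq_top_iff]
        exact TopologicalSpace.Closeds.ext h1
      have hUne : (U₀ : Set Z).Nonempty := by
        by_contra hne
        apply hsupp
        rw [Set.not_nonempty_iff_eq_empty] at hne
        exact Set.compl_empty_iff.mp hne
      haveI hiso : IsIso (blowup.π (C'.map ι) ∣_ U₀) := (blowup.isBlowup (C'.map ι)).isIso_compl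
      -- every point of `U₀` is in the image of `ι`
      have hsub : (U₀ : Set Z) ⊆ (ι.ker.support : Set Z) := by
        intro z hz
        obtain ⟨y, hy⟩ := (asIso (blowup.π (C'.map ι) ∣_ U₀)).hom.homeomorph.surjective ⟨z, hz⟩
        have hπy : blowup.π (C'.map ι) y.1 = z := by
          have h1 := morphismRestrict_base_coe (blowup.π (C'.map ι)) U₀ y
          rw [show (blowup.π (C'.map ι) ∣_ U₀).base y = ⟨z, hz⟩ from hy] at h1
          exact h1.symm
        obtain ⟨u, hu⟩ : ∃ u, (blowup.pushforwardMap C' ι).base u = y.1 := by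
          have h1 : y.1 ∈ Set.range (blowup.pushforwardMap C' ι).base := by rw [hrange]; trivial
          exact h1
        have hz' : z = ι.base ((blowup.π C').base u) := by
          rw [← hπy, ← hu, ← Scheme.Hom.comp_apply, ← Scheme.Hom.comp_apply,
            blowup.pushforwardMap_π]
        rw [hz']
        exact ι.range_subset_ker_support ⟨_, rfl⟩
      -- hence the support of `ker ι` is everything: `ker ι = ⊥`
      apply hker
      rw [← Scheme.IdealSheafData.support_eq_top_iff]
      apply TopologicalSpace.Closeds.ext
      apply Set.eq_univ_of_univ_subset
      rw [← (U₀.2.dense hUne).closure_eq]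
      exact closure_minimal hsub ι.ker.support.isClosed
    obtain ⟨h1, h2, h3, h4, h5, h6, h7, h8⟩ := tower_structural k (blowup.π (C'.map ι) ≫ h) hZ₁i hZ₁
      hdim₁ (blowup.pushforwardMap C' ι) hker₁ rest hrest
    refine ⟨?_, ?_, ?_, h4, h5, h6, h7, ?_⟩
    · simpa [CentreSeq.pushforward_cons, CentreSeq.comp_cons, Category.assoc] using h1
    · simpa [CentreSeq.pushforward_cons, CentreSeq.comp_cons, Category.assoc] using h2
    · simpa [CentreSeq.pushforward_cons, CentreSeq.comp_cons, Category.assoc] using h3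
    · show rest.pushforwardι (blowup.pushforwardMap C' ι) ≫
          (rest.pushforward (blowup.pushforwardMap C' ι)).comp ≫ blowup.π (C'.map ι) =
        (rest.comp ≫ blowup.π C') ≫ ι
      rw [← Category.assoc, h8, Category.assoc, blowup.pushforwardMap_π, Category.assoc]

end Summit.ResolutionOfSingularities.ResolutionOfSingularities.Theorems.SigmaMaxModificationsCorridor3.Helpers

end
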